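import Mathlib
import HarnessLib
import Summits.NavierStokesRegularity.NavierStokesRegularity.Theorems.UnthreadedDoorNetFluxEnvelopeRegularity

/-!
# Route `UnthreadedDoor`, crux `PoloidalLiouville` (stmt-NavierStokesRegularity-1222), WALL W1 `stub_scalarLiouville` —
# crux idea «netflux-typei-gap» (ns-idea-14, LINE v5 = VISCOSITY interface), stub NF-1bᵛ `EnvelopeFacts`, parts (a)–(b):
# CONTINUITY AND ONE-SIDED `r`-DERIVATIVES OF THE SPHERICAL SUP/INF ENVELOPES

KEY-NS #156/#157 (director-ns g16; author ns-idea-14, «NETFLUX LINE v5» bcd4955f0879).  `NetFlux.EnvelopeFacts` asks for: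
(a) joint continuity of `(t,r) ↦ max_{S_r(x₀)} T(t)` and `min_{S_r(x₀)} T(t)` on `]t₀,0[ × ]0,∞[`; (b) ONE-SIDED `r`-derivatives of
`r ↦ r·sphSup (T t) x₀ r` (semiconvex: `∂⁻ ≤ ∂⁺`) and of `r ↦ r·sphInf (T t) x₀ r` (semiconcave: `∂⁺ ≤ ∂⁻`) at every `r > 0`;
(c) the uniform second-difference touching bound (separate file).  This file proves (a) and (b): (a) for the sup is
`continuousOn_sphSup_family` (p662790); the inf is the sup of `−T` (`sphInf_eq_neg_sphSup_neg`); (b) follows from the semiconvexity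
`exists_convexOn_rsphSup_add_sq` (p663304) and Mathlib's one-sided derivatives of convex functions
(`ConvexOn.hasDerivWithinAt_rightDeriv_of_mem_interior`, `…leftDeriv…`, `leftDeriv_le_rightDeriv_of_mem_interior`), subtracting the
smooth `Λr²/2`; the inf case by `T ↦ −T`.

* `sphInf_eq_neg_sphSup_neg`, `rsphInf_eq_neg` — `min f = −max(−f)` on spheres;
* `continuousOn_sphInf_family` — (a) for the inf;
* `exists_oneSided_deriv_rsphSup` — (b) for the sup envelope (`dm ≤ dp`);
* `exists_oneSided_deriv_rsphInf` — (b) for the inf envelope (`dp ≤ dm`).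

WHAT THIS IS NOT: no NS-regularity statement is touched; `EnvelopeFacts` is NOT yet assembled here (part (c) pending);
`PoloidalLiouville` (1222), W1, the line's rung target and the summit stay OPEN.  `--supports stmt-NavierStokesRegularity-1222 --as helper`.
[folklore]
-/

noncomputable section

-- the summit and its single sub-problem share the name (CONVENTIONS §1)
set_option linter.dupNamespace false

open Set Function Filter Topology InnerProductSpace MeasureTheory
open scoped RealInnerProductSpace ContDiff

namespace Summit.NavierStokesRegularity.NavierStokesRegularity.Theorems.PoloidalLiouville.NetFlux

open Literature.Analysis Literature.Analysis.FluidPDE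

variable {T : ℝ → E3 → ℝ} {x₀ : E3} {t₀ : ℝ}

/-! ### `min = − max (−·)` on spheres -/

/-- `min_{S_r(x₀)} f = − max_{S_r(x₀)} (−f)`. [folklore] -/
theorem sphInf_eq_neg_sphSup_neg (f : E3 → ℝ) (x₀ : E3) (r : ℝ) :
    sphInf f x₀ r = -sphSup (fun x => -f x) x₀ r := by
  unfold sphInf sphSup
  rw [Real.sInf_def, neg_inj]
  congr 1
  ext y
  simp only [Set.mem_neg, mem_image]
  constructor
  · rintro ⟨x, hx, h⟩
    exact ⟨x, hx, by rw [h, neg_neg]⟩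
  · rintro ⟨x, hx, h⟩
    exact ⟨x, hx, by rw [← h, neg_neg]⟩

/-- `r · min_{S_r(x₀)} f = −(r · max_{S_r(x₀)} (−f))`. [folklore] -/
theorem rsphInf_eq_neg (f : E3 → ℝ) (x₀ : E3) (r : ℝ) :
    r * sphInf f x₀ r = -(r * sphSup (fun x => -f x) x₀ r) := by
  rw [sphInf_eq_neg_sphSup_neg, mul_neg]

/-- Smoothness off the centre is preserved by `T ↦ −T`. [folklore] -/
theorem contDiffOn_neg_family (hT : ContDiffOn ℝ (⊤ : ℕ∞) (uncurry T) (Ioo t₀ 0 ×ˢ ({x₀}ᶜ : Set E3))) :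
    ContDiffOn ℝ (⊤ : ℕ∞) (uncurry fun t x => -T t x) (Ioo t₀ 0 ×ˢ ({x₀}ᶜ : Set E3)) :=
  hT.neg

/-! ### (a) joint continuity of the inf envelope -/

/-- **`(t,r) ↦ min_{S_r(x₀)} T(t)` is continuous on `]t₀,0[ × ]0,∞[`** for `T` continuous off the centre. [folklore] -/
theorem continuousOn_sphInf_family (hT : ContinuousOn (uncurry T) (Ioo t₀ 0 ×ˢ ({x₀}ᶜ : Set E3))) :
    ContinuousOn (fun p : ℝ × ℝ => sphInf (T p.1) x₀ p.2) (Ioo t₀ 0 ×ˢ Ioi 0) := by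
  have hneg : ContinuousOn (uncurry fun t x => -T t x) (Ioo t₀ 0 ×ˢ ({x₀}ᶜ : Set E3)) := hT.neg
  have h := continuousOn_sphSup_family (T := fun t x => -T t x) hneg
  have e : (fun p : ℝ × ℝ => sphInf (T p.1) x₀ p.2) = fun p => -sphSup (fun x => -T p.1 x) x₀ p.2 :=
    funext fun p => sphInf_eq_neg_sphSup_neg (T p.1) x₀ p.2
  rw [e]
  exact h.neg

/-! ### (b) one-sided `r`-derivatives of the envelopes -/

/-- **One-sided derivatives of the semiconvex sup envelope**: for `t ∈ ]t₀,0[` and `r > 0` the function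
`ρ ↦ ρ · max_{S_ρ(x₀)} T(t)` has a right derivative `dp` and a left derivative `dm` at `r`, with `dm ≤ dp`
(`ρ·sphSup + Λρ²/2` is convex near `r`, `exists_convexOn_rsphSup_add_sq`; one-sided derivatives of convex functions). [folklore] -/
theorem exists_oneSided_deriv_rsphSup (hT : ContDiffOn ℝ (⊤ : ℕ∞) (uncurry T) (Ioo t₀ 0 ×ˢ ({x₀}ᶜ : Set E3)))
    {t : ℝ} (ht : t ∈ Ioo t₀ 0) {r : ℝ} (hr : 0 < r) :
    ∃ dp dm : ℝ, HasDerivWithinAt (fun ρ => ρ * sphSup (T t) x₀ ρ) dp (Ioi r) r ∧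
      HasDerivWithinAt (fun ρ => ρ * sphSup (T t) x₀ ρ) dm (Iio r) r ∧ dm ≤ dp := by
  -- a compact interval around `r` inside `]0,∞[`
  have hc : 0 < r / 2 := by positivity
  obtain ⟨Λ, hconv⟩ := exists_convexOn_rsphSup_add_sq hT ht hc (d := 2 * r)
  have hint : r ∈ interior (Icc (r / 2) (2 * r)) := by
    rw [interior_Icc]; exact ⟨by linarith, by linarith⟩
  set g : ℝ → ℝ := fun ρ => ρ * sphSup (T t) x₀ ρ + Λ / 2 * ρ ^ 2 with hg
  have hR := hconv.hasDerivWithinAt_rightDeriv_of_mem_interior hint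
  have hL := hconv.hasDerivWithinAt_leftDeriv_of_mem_interior hint
  have hle := hconv.leftDeriv_le_rightDeriv_of_mem_interior hint
  -- subtract the smooth quadratic
  have hq : ∀ s : Set ℝ, HasDerivWithinAt (fun ρ : ℝ => Λ / 2 * ρ ^ 2) (Λ * r) s r := by
    intro s
    have h0 : HasDerivAt (fun ρ : ℝ => Λ / 2 * ρ ^ 2) (Λ / 2 * ((2 : ℕ) * r ^ (2 - 1))) r :=
      (hasDerivAt_pow 2 r).const_mul (Λ / 2)
    have h1 : HasDerivAt (fun ρ : ℝ => Λ / 2 * ρ ^ 2) (Λ * r) r :=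
      h0.congr_deriv (by rw [show (2 : ℕ) - 1 = 1 from rfl, pow_one]; push_cast; ring)
    exact h1.hasDerivWithinAt
  have hkey : ∀ (s : Set ℝ) (d : ℝ), HasDerivWithinAt g d s r →
      HasDerivWithinAt (fun ρ => ρ * sphSup (T t) x₀ ρ) (d - Λ * r) s r := by
    intro s d hd
    have h := hd.sub (hq s)
    refine h.congr (fun ρ _ => ?_) ?_
    · simp only [hg, Pi.sub_apply]; ring
    · simp only [hg, Pi.sub_apply]; ring
  refine ⟨derivWithin g (Ioi r) r - Λ * r, derivWithin g (Iio r) r - Λ * r, hkey _ _ hR, hkey _ _ hL, ?_⟩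
  linarith

/-- **One-sided derivatives of the semiconcave inf envelope**: for `t ∈ ]t₀,0[` and `r > 0` the function
`ρ ↦ ρ · min_{S_ρ(x₀)} T(t)` has a right derivative `dp` and a left derivative `dm` at `r`, with `dp ≤ dm`
(it is minus the sup envelope of `−T`). [folklore] -/
theorem exists_oneSided_deriv_rsphInf (hT : ContDiffOn ℝ (⊤ : ℕ∞) (uncurry T) (Ioo t₀ 0 ×ˢ ({x₀}ᶜ : Set E3)))
    {t : ℝ} (ht : t ∈ Ioo t₀ 0) {r : ℝ} (hr : 0 < r) :
    ∃ dp dm : ℝ, HasDerivWithinAt (fun ρ => ρ * sphInf (T t) x₀ ρ) dp (Ioi r) r ∧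
      HasDerivWithinAt (fun ρ => ρ * sphInf (T t) x₀ ρ) dm (Iio r) r ∧ dp ≤ dm := by
  obtain ⟨dp, dm, hp, hm, hle⟩ :=
    exists_oneSided_deriv_rsphSup (T := fun t x => -T t x) (contDiffOn_neg_family hT) ht hr
  have e : (fun ρ => ρ * sphInf (T t) x₀ ρ) = fun ρ => -(ρ * sphSup (fun x => -T t x) x₀ ρ) :=
    funext fun ρ => rsphInf_eq_neg (T t) x₀ ρ
  refine ⟨-dp, -dm, ?_, ?_, by linarith⟩
  · rw [e]; exact hp.neg
  · rw [e]; exact hm.neg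

end Summit.NavierStokesRegularity.NavierStokesRegularity.Theorems.PoloidalLiouville.NetFlux

end
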